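import Summits.CriticalPhenomena.PercolationContinuityZ3.Theorems.PercAnnulusCrossingNoiseFourier
import HarnessLib

/-!
# RSW3 lane (lead, gen 22): HYPERCONTRACTIVITY OF THE NOISE OPERATOR, I — the Bonami–Beckner `(2,4)` inequality
# on the p-biased box cube with degenerate coordinates

builds on p205010 (kernel theorem, internal audit signed; external expert review pending) — NOT used in this file (abstract).

Cell `prim-rsw3` (LANE 3), lead seat, gen 22.  Support file (`--supports stmt-CriticalPhenomena-4575`); no definitions, no named facts,
no sorries.  Setting of gens 20–21 (`…NoiseFourier`, `…NoiseStability`): a finite product cube `{0,1}^ι` with biases `p_i ∈ [0,1]`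
(degenerate coordinates allowed — the lane's box cube has bias `0` off the lattice edges), product weight `wt p`, and the NOISE OPERATOR
written out as the double sum

  `T_ε f (x) = Σ_y Σ_m wt_p(y)·wt_ε̄(m)·f(ω^m(x,y))`,  `ω^m(x,y)_i = y_i` if `m_i = 1` (resampled, probability `ε`), `= x_i` otherwise,

whose Walsh coefficients are `(1 − ε)^{|S|}·f̂(S)` (`noise_coeff`, gen 20).  Proved here, with `ρ = 1 − ε`:

* `two_point_fourth_moment_le` — the polynomial two-point inequality `q(a + (1−q)b)⁴ + (1−q)(a − qb)⁴ ≤ a⁴ + 8q(1−q)a²b² + 3q(1−q)b⁴`;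
* `two_point_hypercontractive` — for the p-biased character `r(b) = (𝟙[b] − q)/√(q(1−q))` of ONE coordinate of bias `q ∈ [0,1]` and every
  `ρ` with `ρ² ≤ 1/4` and `3ρ⁴ ≤ q(1−q)` (when `0 < q < 1`): `E_b[(A + ρ·r(b)·B)⁴] ≤ A⁴ + 2A²B² + B⁴` (a degenerate coordinate has `r = 0`);
* `sum_wt_eq_sum_cons`, `mix_cons`, `noise_cons` — splitting the cube `{0,1}^{n+1} = {0,1} × {0,1}^n` along the first coordinate: the weight
  factorises and `T_ε f(b, x') = (1−ε)·T'_ε f_b(x') + ε·T'_ε g(x')` with `f_b = f(b, ·)`, `g = Σ_c w(c) f_c` (`T'` the operator of the other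
  coordinates);
* `cons_decomposition`, `second_moment_cons`, `noise_cons_eq`, `fourth_moment_cons_le` — on the support, `f_b = g + r(b)·h` with
  `h = Σ_c w(c) r(c) f_c`, `E_b[f_b²] = g² + h²`, `T_ε f(b,·) = T'g + ρ·r(b)·T'h`, and the two-point inequality pointwise in `x'`;
These are the two-point step and the splitting identities of the induction; part II (`…NoiseBonami`) runs the induction on the dimension
and transports it to any finite index type: for every `p ∈ [0,1]^ι` and every `ε` with `(1−ε)² ≤ 1/4` and `3(1−ε)⁴ ≤ p_i(1−p_i)` at
each nondegenerate coordinate, **`E_p[(T_ε f)⁴] ≤ (E_p[f²])²`**, i.e. `‖T_{1−ε} f‖₄ ≤ ‖f‖₂` (uniform cube: `ρ² ≤ 1/4`, against Bonami's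
sharp `1/3`; on the lane's lattice cube at `p_c(ℤ³) ∈ (0.2, 0.3)` any `ρ ≤ 0.48` works).  Part III (`…NoiseSmallSets`) turns this into
the `(4/3, 2)` bound `Σ_S ρ^{2|S|} 𝟙̂_A(S)² ≤ P(A)^{3/2}`, the level-`k` inequality and the small-set expansion of the noisy cube; part IV
applies them to rare percolation events (the critical arm, long connections).

References: A. Bonami, Ann. Inst. Fourier 20 (1970) 335–402 (Lemme 3: the `(2,4)` inequality on `{−1,1}^n`); R. O'Donnell, *Analysis of
Boolean Functions*, CUP 2014, §9.1 Thm 9.21 (Bonami lemma by induction on `n`), §10.1 Prop 10.13/Thm 10.21 (reasonable random variables,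
p-biased bits: `(2,4,ρ)`-hypercontractivity with `ρ` depending on `λ = min(p,1−p)`); C. Garban, J. Steif, *Noise sensitivity of Boolean
functions and percolation*, CUP 2014, Ch. V Thm V.2 (the induction step `E[(a+ρxb)⁴]`).
-/

noncomputable section

namespace Summit.CriticalPhenomena.PercolationContinuityZ3.Theorems.Crossing.Spectral

open Finset Function
open Literature.Probability.ODonnellSaksSchrammServedio2005

/-! ## §1 The two-point inequality -/

/-- **THE POLYNOMIAL TWO-POINT INEQUALITY**: for `0 ≤ q ≤ 1` and all real `a, b`,
`q(a + (1−q)b)⁴ + (1−q)(a − qb)⁴ ≤ a⁴ + 8q(1−q)·a²b² + 3q(1−q)·b⁴` — the left side is `E[(a + Rb)⁴]` for the centred two-point variable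
`R = 1 − q` w.p. `q`, `−q` w.p. `1 − q` (`E R = 0`, `E R² = q(1−q)`, `E R³ = q(1−q)(1−2q)`, `E R⁴ = q(1−q)(1 − 3q(1−q))`), and the slack is
`q(1−q)·(2(ab − (1−2q)b²)² + 11q(1−q)b⁴) ≥ 0`. [cite: ODonnell2014, §9.1 Thm 9.21 (proof: E[(a+xb)⁴] = a⁴ + 6a²b² + b⁴) and §10.1 Prop 10.13] -/
theorem two_point_fourth_moment_le (q a b : ℝ) (hq0 : 0 ≤ q) (hq1 : q ≤ 1) :
    q * (a + (1 - q) * b) ^ 4 + (1 - q) * (a - q * b) ^ 4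
      ≤ a ^ 4 + 8 * (q * (1 - q)) * (a ^ 2 * b ^ 2) + 3 * (q * (1 - q)) * b ^ 4 := by
  have hs : 0 ≤ q * (1 - q) := mul_nonneg hq0 (by linarith)
  have hid : q * (a + (1 - q) * b) ^ 4 + (1 - q) * (a - q * b) ^ 4
      = a ^ 4 + (q * (1 - q)) * (6 * (a ^ 2 * b ^ 2) + 4 * (1 - 2 * q) * (a * b ^ 3)
          + (1 - 3 * (q * (1 - q))) * b ^ 4) := by ring
  have hslack : (8 * (a ^ 2 * b ^ 2) + 3 * b ^ 4)
      - (6 * (a ^ 2 * b ^ 2) + 4 * (1 - 2 * q) * (a * b ^ 3) + (1 - 3 * (q * (1 - q))) * b ^ 4)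
      = 2 * (a * b - (1 - 2 * q) * b ^ 2) ^ 2 + 11 * (q * (1 - q)) * (b ^ 2) ^ 2 := by ring
  have hbr : 6 * (a ^ 2 * b ^ 2) + 4 * (1 - 2 * q) * (a * b ^ 3) + (1 - 3 * (q * (1 - q))) * b ^ 4
      ≤ 8 * (a ^ 2 * b ^ 2) + 3 * b ^ 4 := by
    have : 0 ≤ 2 * (a * b - (1 - 2 * q) * b ^ 2) ^ 2 + 11 * (q * (1 - q)) * (b ^ 2) ^ 2 := by positivity
    linarith
  rw [hid]
  nlinarith [mul_le_mul_of_nonneg_left hbr hs]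

/-- **THE TWO-POINT HYPERCONTRACTIVE INEQUALITY AT ONE COORDINATE OF BIAS `q ∈ [0,1]`**: with the p-biased character
`r(b) = (𝟙[b] − q)/√(q(1−q))` (`= 0` at a degenerate coordinate, `/0 = 0`) and any `ρ` with `ρ² ≤ 1/4` and `3ρ⁴ ≤ q(1−q)` whenever `0 < q < 1`,
`q·(A + ρ r(1) B)⁴ + (1−q)·(A + ρ r(0) B)⁴ ≤ A⁴ + 2A²B² + B⁴` — the one-coordinate case of `‖T_ρ f‖₄ ≤ ‖f‖₂` for `f = A + B·r`, in the squared
form used by the induction. (Substitute `B' = ρB/√(q(1−q))` in `two_point_fourth_moment_le`; `8q(1−q)B'² = 8ρ²B² ≤ 2B²` and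
`3q(1−q)B'⁴ = 3ρ⁴B⁴/(q(1−q)) ≤ B⁴`.) [cite: ODonnell2014, §10.1 Thm 10.21 / Cor 10.19 (λ-biased bits are (2,4,ρ)-hypercontractive)]
[cite: Bonami1970, Ch. III Lemme 3 (the case q = 1/2, ρ ≤ 1/√3)] -/
theorem two_point_hypercontractive (q : ℝ) (hq0 : 0 ≤ q) (hq1 : q ≤ 1) {ρ : ℝ} (hρ2 : ρ ^ 2 ≤ 1 / 4)
    (hρ4 : 0 < q → q < 1 → 3 * ρ ^ 4 ≤ q * (1 - q)) (A B : ℝ) :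
    q * (A + ρ * (((if true then (1 : ℝ) else 0) - q) / Real.sqrt (q * (1 - q))) * B) ^ 4
      + (1 - q) * (A + ρ * (((if false then (1 : ℝ) else 0) - q) / Real.sqrt (q * (1 - q))) * B) ^ 4
      ≤ A ^ 4 + 2 * (A ^ 2 * B ^ 2) + B ^ 4 := by
  simp only [if_true, Bool.false_eq_true, if_false]
  by_cases hnd : 0 < q ∧ q < 1
  · obtain ⟨hq0', hq1'⟩ := hnd
    have hs2pos : 0 < q * (1 - q) := mul_pos hq0' (by linarith)
    set s : ℝ := Real.sqrt (q * (1 - q)) with hs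
    have hss : s ^ 2 = q * (1 - q) := by rw [hs, Real.sq_sqrt hs2pos.le]
    have hs0 : 0 < s := by rw [hs]; exact Real.sqrt_pos.2 hs2pos
    set B' : ℝ := ρ * B / s with hB'
    have h1 : A + ρ * ((1 - q) / s) * B = A + (1 - q) * B' := by rw [hB']; field_simp
    have h2 : A + ρ * ((0 - q) / s) * B = A - q * B' := by rw [hB']; field_simp; ring
    rw [h1, h2]
    have hL := two_point_fourth_moment_le q A B' hq0 hq1
    -- `s·B' = ρ·B`
    have hsB : s * B' = ρ * B := by rw [hB']; field_simp
    have hsB2 : q * (1 - q) * B' ^ 2 = ρ ^ 2 * B ^ 2 := by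
      calc q * (1 - q) * B' ^ 2 = (s * B') ^ 2 := by rw [← hss]; ring
        _ = (ρ * B) ^ 2 := by rw [hsB]
        _ = ρ ^ 2 * B ^ 2 := by ring
    have hmid : 8 * (q * (1 - q)) * (A ^ 2 * B' ^ 2) ≤ 2 * (A ^ 2 * B ^ 2) := by
      have : 8 * (q * (1 - q)) * (A ^ 2 * B' ^ 2) = 8 * ρ ^ 2 * (A ^ 2 * B ^ 2) := by
        calc 8 * (q * (1 - q)) * (A ^ 2 * B' ^ 2) = 8 * A ^ 2 * (q * (1 - q) * B' ^ 2) := by ring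
          _ = 8 * A ^ 2 * (ρ ^ 2 * B ^ 2) := by rw [hsB2]
          _ = 8 * ρ ^ 2 * (A ^ 2 * B ^ 2) := by ring
      rw [this]
      nlinarith [sq_nonneg A, sq_nonneg B, mul_nonneg (sq_nonneg A) (sq_nonneg B)]
    have htail : 3 * (q * (1 - q)) * B' ^ 4 ≤ B ^ 4 := by
      -- `3 s² B'⁴ · s² = 3 (ρ²B²)² = 3ρ⁴ B⁴ ≤ s² B⁴`
      have h3 : 3 * (q * (1 - q)) * B' ^ 4 * (q * (1 - q)) = 3 * ρ ^ 4 * B ^ 4 := by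
        have : (q * (1 - q)) * B' ^ 4 * (q * (1 - q)) = ((q * (1 - q)) * B' ^ 2) ^ 2 := by ring
        calc 3 * (q * (1 - q)) * B' ^ 4 * (q * (1 - q)) = 3 * (((q * (1 - q)) * B' ^ 2) ^ 2) := by ring
          _ = 3 * ρ ^ 4 * B ^ 4 := by rw [hsB2]; ring
      have h4 : 3 * ρ ^ 4 * B ^ 4 ≤ (q * (1 - q)) * B ^ 4 :=
        mul_le_mul_of_nonneg_right (hρ4 hq0' hq1') (by positivity)
      by_contra hcon
      push Not at hcon
      have : B ^ 4 * (q * (1 - q)) < 3 * (q * (1 - q)) * B' ^ 4 * (q * (1 - q)) :=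
        mul_lt_mul_of_pos_right hcon hs2pos
      nlinarith
    linarith
  · -- degenerate coordinate: `√(q(1−q)) = 0`, the character vanishes
    have hdeg : q = 0 ∨ q = 1 := by
      rcases eq_or_lt_of_le hq0 with h | h
      · exact Or.inl h.symm
      · rcases eq_or_lt_of_le hq1 with h' | h'
        · exact Or.inr h'
        · exact absurd ⟨h, h'⟩ hnd
    have hsq : Real.sqrt (q * (1 - q)) = 0 := by
      rcases hdeg with h | h <;> rw [h] <;> simp
    rw [hsq]
    simp only [div_zero, mul_zero, zero_mul, add_zero]
    nlinarith [sq_nonneg A, sq_nonneg B, mul_nonneg (sq_nonneg A) (sq_nonneg B), hq0, hq1]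


/-! ## §2 Splitting the cube `{0,1}^{n+1} = {0,1} × {0,1}^n` along the first coordinate -/

section Cons

variable {n : ℕ}

/-- **The product weight factorises along the first coordinate**: `Σ_x wt_p(x)·F(x) = Σ_b w₀(b)·Σ_{x'} wt_{p'}(x')·F(b, x')` with
`p' = p ∘ succ`. [cite: ODonnell2014, §8.4 (the p-biased product distribution π_p^{⊗n})] -/
theorem sum_wt_eq_sum_cons (p : Fin (n + 1) → ℝ) (F : (Fin (n + 1) → Bool) → ℝ) :
    ∑ x : Fin (n + 1) → Bool, wt p x * F x
      = ∑ b : Bool, coordWt p 0 b * ∑ x' : Fin n → Bool, wt (fun i => p i.succ) x' * F (Fin.cons b x') := by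
  have hq : ∀ q : Bool × (Fin n → Bool),
      coordWt p 0 q.1 * (wt (fun i => p i.succ) q.2 * F (Fin.cons q.1 q.2))
        = wt p ((Fin.consEquiv fun _ => Bool) q) * F ((Fin.consEquiv fun _ => Bool) q) := by
    intro q
    have he : (Fin.consEquiv fun _ => Bool) q = Fin.cons q.1 q.2 := rfl
    rw [he]
    simp only [wt, Fin.prod_univ_succ, Fin.cons_zero, Fin.cons_succ, coordWt]
    ring
  rw [← Fintype.sum_equiv (Fin.consEquiv fun _ => Bool)
    (fun q => coordWt p 0 q.1 * (wt (fun i => p i.succ) q.2 * F (Fin.cons q.1 q.2))) (fun x => wt p x * F x) hq,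
    Fintype.sum_prod_type]
  simp only [Finset.mul_sum]

/-- The resampled point splits along the first coordinate: `ω^{(μ,m')}((b,x'),(c,y')) = (μ ? c : b, ω^{m'}(x',y'))`. [folklore] -/
theorem mix_cons (b c μ : Bool) (x' y' m' : Fin n → Bool) :
    (fun i => if (Fin.cons μ m' : Fin (n + 1) → Bool) i = true then (Fin.cons c y' : Fin (n + 1) → Bool) i
        else (Fin.cons b x' : Fin (n + 1) → Bool) i)
      = Fin.cons (if μ = true then c else b) (fun j => if m' j = true then y' j else x' j) := by
  funext i
  refine Fin.cases ?_ (fun j => ?_) i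
  · simp only [Fin.cons_zero]
  · simp only [Fin.cons_succ]

/-- **THE NOISE OPERATOR ALONG THE FIRST COORDINATE**: `T_ε f(b, x') = (1−ε)·T'_ε f_b(x') + ε·Σ_c w₀(c)·T'_ε f_c(x')`, where `f_c = f(c, ·)` and
`T'` is the noise operator of the remaining coordinates (the first coordinate is kept with probability `1 − ε` and resampled with
probability `ε`). [cite: ODonnell2014, §2.4 Def 2.46 / §8.4 (T_ρ acts coordinatewise: T_ρ = ⊗_i T_ρ^{(i)})] -/
theorem noise_cons (p : Fin (n + 1) → ℝ) (ε : ℝ) (f : (Fin (n + 1) → Bool) → ℝ) (b : Bool) (x' : Fin n → Bool) :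
    (∑ y : Fin (n + 1) → Bool, ∑ m : Fin (n + 1) → Bool, wt p y * wt (fun _ => ε) m
        * f (fun i => if m i = true then y i else (Fin.cons b x' : Fin (n + 1) → Bool) i))
      = (1 - ε) * (∑ y' : Fin n → Bool, ∑ m' : Fin n → Bool, wt (fun i => p i.succ) y' * wt (fun _ => ε) m'
            * f (Fin.cons b (fun j => if m' j = true then y' j else x' j)))
        + ε * ∑ c : Bool, coordWt p 0 c * (∑ y' : Fin n → Bool, ∑ m' : Fin n → Bool,
            wt (fun i => p i.succ) y' * wt (fun _ => ε) m' * f (Fin.cons c (fun j => if m' j = true then y' j else x' j))) := by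
  -- the sum over `y`
  have hy : ∀ y : Fin (n + 1) → Bool, ∑ m : Fin (n + 1) → Bool, wt p y * wt (fun _ => ε) m
      * f (fun i => if m i = true then y i else (Fin.cons b x' : Fin (n + 1) → Bool) i)
      = wt p y * ∑ m : Fin (n + 1) → Bool, wt (fun _ => ε) m
          * f (fun i => if m i = true then y i else (Fin.cons b x' : Fin (n + 1) → Bool) i) := by
    intro y
    rw [Finset.mul_sum]
    exact Finset.sum_congr rfl fun m _ => by ring
  rw [Finset.sum_congr rfl (fun y _ => hy y), sum_wt_eq_sum_cons p]
  -- the sum over `m`, for `y = (c, y')`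
  have hm : ∀ (c : Bool) (y' : Fin n → Bool),
      ∑ m : Fin (n + 1) → Bool, wt (fun _ => ε) m
          * f (fun i => if m i = true then (Fin.cons c y' : Fin (n + 1) → Bool) i else (Fin.cons b x' : Fin (n + 1) → Bool) i)
        = ε * (∑ m' : Fin n → Bool, wt (fun _ => ε) m' * f (Fin.cons c (fun j => if m' j = true then y' j else x' j)))
          + (1 - ε) * (∑ m' : Fin n → Bool, wt (fun _ => ε) m' * f (Fin.cons b (fun j => if m' j = true then y' j else x' j))) := by
    intro c y'
    rw [sum_wt_eq_sum_cons (fun _ : Fin (n + 1) => ε), Fintype.sum_bool]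
    simp only [mix_cons, if_true, Bool.false_eq_true, if_false, coordWt]
  simp only [hm]
  -- bookkeeping: both sides are the same linear combination
  have hw : coordWt p 0 true + coordWt p 0 false = 1 := by simp [coordWt]
  have hL : ∀ c : Bool,
      ∑ y' : Fin n → Bool, wt (fun i => p i.succ) y' *
          (ε * (∑ m' : Fin n → Bool, wt (fun _ => ε) m' * f (Fin.cons c (fun j => if m' j = true then y' j else x' j)))
            + (1 - ε) * (∑ m' : Fin n → Bool, wt (fun _ => ε) m' * f (Fin.cons b (fun j => if m' j = true then y' j else x' j))))
        = ε * (∑ y' : Fin n → Bool, ∑ m' : Fin n → Bool, wt (fun i => p i.succ) y' * wt (fun _ => ε) m'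
            * f (Fin.cons c (fun j => if m' j = true then y' j else x' j)))
          + (1 - ε) * (∑ y' : Fin n → Bool, ∑ m' : Fin n → Bool, wt (fun i => p i.succ) y' * wt (fun _ => ε) m'
            * f (Fin.cons b (fun j => if m' j = true then y' j else x' j))) := by
    intro c
    rw [Finset.mul_sum, Finset.mul_sum, ← Finset.sum_add_distrib]
    refine Finset.sum_congr rfl fun y' _ => ?_
    simp only [Finset.mul_sum, mul_add, ← Finset.sum_add_distrib]
    exact Finset.sum_congr rfl fun m' _ => by ring
  simp only [hL]
  rw [Fintype.sum_bool, Fintype.sum_bool]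
  linear_combination ((1 - ε) * (∑ y' : Fin n → Bool, ∑ m' : Fin n → Bool, wt (fun i => p i.succ) y' * wt (fun _ => ε) m'
            * f (Fin.cons b (fun j => if m' j = true then y' j else x' j)))) * hw

/-- **THE TWO-DIMENSIONAL SPACE OF ONE COORDINATE**: on the support of the first coordinate (`w₀(b) ≠ 0`),
`f(b, x') = g(x') + r(b)·h(x')` with `g = Σ_c w₀(c) f_c` (the average over the first coordinate), `h = Σ_c w₀(c) r(c) f_c` (its first-coordinate
coefficient) and `r` the p-biased character of bias `p₀` — the reproducing kernel (H2) `w₀(c)(1 + r(b)r(c)) = 𝟙[c = b]`.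
[cite: ODonnell2014, §8.4 Thm 8.30 (f = Σ_S f̂(S) φ_S, one coordinate at a time) and §9.1 (proof of Thm 9.21: f = g + x_n h)] -/
theorem cons_decomposition (p : Fin (n + 1) → ℝ) (h0 : ∀ i, 0 ≤ p i) (h1 : ∀ i, p i ≤ 1)
    (f : (Fin (n + 1) → Bool) → ℝ) {b : Bool} (hb : coordWt p 0 b ≠ 0) (x' : Fin n → Bool) :
    f (Fin.cons b x') = (∑ c : Bool, coordWt p 0 c * f (Fin.cons c x'))
      + (((if b then (1 : ℝ) else 0) - p 0) / Real.sqrt (p 0 * (1 - p 0)))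
        * ∑ c : Bool, coordWt p 0 c * ((((if c then (1 : ℝ) else 0) - p 0) / Real.sqrt (p 0 * (1 - p 0))) * f (Fin.cons c x')) := by
  have hH2 := pbiased_H2 p h0 h1 0 b
  calc f (Fin.cons b x') = ∑ c : Bool, (if c = b then (1 : ℝ) else 0) * f (Fin.cons c x') := by
        rw [Fintype.sum_bool]; cases b <;> simp
    _ = ∑ c : Bool, (coordWt p 0 c * (1 + (((if b then (1 : ℝ) else 0) - p 0) / Real.sqrt (p 0 * (1 - p 0)))
          * (((if c then (1 : ℝ) else 0) - p 0) / Real.sqrt (p 0 * (1 - p 0))))) * f (Fin.cons c x') := by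
        refine Finset.sum_congr rfl fun c _ => ?_
        rw [hH2 c hb]
    _ = (∑ c : Bool, coordWt p 0 c * f (Fin.cons c x'))
      + (((if b then (1 : ℝ) else 0) - p 0) / Real.sqrt (p 0 * (1 - p 0)))
        * ∑ c : Bool, coordWt p 0 c * ((((if c then (1 : ℝ) else 0) - p 0) / Real.sqrt (p 0 * (1 - p 0)))
          * f (Fin.cons c x')) := by
        rw [Finset.mul_sum, ← Finset.sum_add_distrib]
        exact Finset.sum_congr rfl fun c _ => by ring

/-- **THE SECOND MOMENT ALONG THE FIRST COORDINATE**: `Σ_b w₀(b)·f(b,x')² = g(x')² + h(x')²` — orthonormality of `{1, r}` at a nondegenerate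
coordinate (`E r = 0`, `E r² = 1`); at a degenerate one `h = 0`. [cite: ODonnell2014, §8.4 Prop 8.29 and §9.1 (proof of Thm 9.21: E[f²] = E[g²] + E[h²])] -/
theorem second_moment_cons (p : Fin (n + 1) → ℝ) (h0 : ∀ i, 0 ≤ p i) (h1 : ∀ i, p i ≤ 1)
    (f : (Fin (n + 1) → Bool) → ℝ) (x' : Fin n → Bool) :
    ∑ b : Bool, coordWt p 0 b * f (Fin.cons b x') ^ 2
      = (∑ c : Bool, coordWt p 0 c * f (Fin.cons c x')) ^ 2
        + (∑ c : Bool, coordWt p 0 c * ((((if c then (1 : ℝ) else 0) - p 0) / Real.sqrt (p 0 * (1 - p 0)))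
            * f (Fin.cons c x'))) ^ 2 := by
  have hH1 := pbiased_H1 p (0 : Fin (n + 1))
  have hH2 := pbiased_H2 p h0 h1
  set g : ℝ := ∑ c : Bool, coordWt p 0 c * f (Fin.cons c x') with hg
  set h : ℝ := ∑ c : Bool, coordWt p 0 c * ((((if c then (1 : ℝ) else 0) - p 0) / Real.sqrt (p 0 * (1 - p 0)))
            * f (Fin.cons c x')) with hh
  -- termwise `w(b) f_b² = w(b) (g + r(b) h)²`
  have key : ∀ b : Bool, coordWt p 0 b * f (Fin.cons b x') ^ 2
      = coordWt p 0 b * (g + (((if b then (1 : ℝ) else 0) - p 0) / Real.sqrt (p 0 * (1 - p 0))) * h) ^ 2 := by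
    intro b
    by_cases hb : coordWt p 0 b = 0
    · rw [hb, zero_mul, zero_mul]
    · rw [← cons_decomposition p h0 h1 f hb x']
  rw [Finset.sum_congr rfl (fun b _ => key b), Fintype.sum_bool]
  have hm2 := second_moment_eq_ite (r := fun i b => ((if b then (1 : ℝ) else 0) - p i) / Real.sqrt (p i * (1 - p i)))
    h0 h1 hH2 (0 : Fin (n + 1))
  simp only [coordWt, if_true, Bool.false_eq_true, if_false] at hH1 hm2 ⊢
  by_cases hnd : 0 < p 0 ∧ p 0 < 1
  · rw [if_pos hnd] at hm2
    linear_combination (2 * g * h) * hH1 + h ^ 2 * hm2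
  · rw [if_neg hnd] at hm2
    -- `h = 0`: every `w(c)·r(c) = 0`
    have hz : h = 0 := by
      rw [hh, Fintype.sum_bool]
      have hc : ∀ c : Bool, coordWt p 0 c * ((((if c then (1 : ℝ) else 0) - p 0) / Real.sqrt (p 0 * (1 - p 0)))
          * f (Fin.cons c x')) = 0 := by
        intro c
        by_cases hwc : coordWt p 0 c = 0
        · rw [hwc, zero_mul]
        · have hr := char_eq_zero_of_degenerate
            (r := fun i b => ((if b then (1 : ℝ) else 0) - p i) / Real.sqrt (p i * (1 - p i))) h0 h1 hH2 0 hnd c hwc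
          rw [hr, zero_mul, mul_zero]
      rw [hc true, hc false, add_zero]
    rw [hz]
    ring

/-- **THE NOISE OPERATOR ON THE TWO-DIMENSIONAL SPACE**: on the support of the first coordinate,
`T_ε f(b, x') = T'_ε g(x') + (1−ε)·r(b)·T'_ε h(x')` — the first coordinate's character is an eigenvector of the noise with eigenvalue
`ρ = 1 − ε`. [cite: ODonnell2014, §9.1 (proof of Thm 9.21: T_ρ f = T_ρ g + ρ x_n T_ρ h) and §8.4 / §2.4 Prop 2.47] -/
theorem noise_cons_eq (p : Fin (n + 1) → ℝ) (h0 : ∀ i, 0 ≤ p i) (h1 : ∀ i, p i ≤ 1) (ε : ℝ)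
    (f : (Fin (n + 1) → Bool) → ℝ) {b : Bool} (hb : coordWt p 0 b ≠ 0) (x' : Fin n → Bool) :
    (∑ y : Fin (n + 1) → Bool, ∑ m : Fin (n + 1) → Bool, wt p y * wt (fun _ => ε) m
        * f (fun i => if m i = true then y i else (Fin.cons b x' : Fin (n + 1) → Bool) i))
      = (∑ y' : Fin n → Bool, ∑ m' : Fin n → Bool, wt (fun i => p i.succ) y' * wt (fun _ => ε) m'
            * (∑ c : Bool, coordWt p 0 c * f (Fin.cons c (fun j => if m' j = true then y' j else x' j))))
        + (1 - ε) * ((((if b then (1 : ℝ) else 0) - p 0) / Real.sqrt (p 0 * (1 - p 0)))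
          * ∑ y' : Fin n → Bool, ∑ m' : Fin n → Bool, wt (fun i => p i.succ) y' * wt (fun _ => ε) m'
            * (∑ c : Bool, coordWt p 0 c * ((((if c then (1 : ℝ) else 0) - p 0) / Real.sqrt (p 0 * (1 - p 0)))
              * f (Fin.cons c (fun j => if m' j = true then y' j else x' j))))) := by
  rw [noise_cons p ε f b x']
  have hd : ∀ z : Fin n → Bool, f (Fin.cons b z) = (∑ c : Bool, coordWt p 0 c * f (Fin.cons c z))
      + (((if b then (1 : ℝ) else 0) - p 0) / Real.sqrt (p 0 * (1 - p 0)))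
        * ∑ c : Bool, coordWt p 0 c * ((((if c then (1 : ℝ) else 0) - p 0) / Real.sqrt (p 0 * (1 - p 0))) * f (Fin.cons c z)) :=
    fun z => cons_decomposition p h0 h1 f hb z
  simp only [hd]
  -- exchange the sum over `c` with the sums over `y', m'`
  have hswap : ∑ c : Bool, coordWt p 0 c * (∑ y' : Fin n → Bool, ∑ m' : Fin n → Bool,
        wt (fun i => p i.succ) y' * wt (fun _ => ε) m' * f (Fin.cons c (fun j => if m' j = true then y' j else x' j)))
      = ∑ y' : Fin n → Bool, ∑ m' : Fin n → Bool, wt (fun i => p i.succ) y' * wt (fun _ => ε) m'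
          * (∑ c : Bool, coordWt p 0 c * f (Fin.cons c (fun j => if m' j = true then y' j else x' j))) := by
    simp only [Finset.mul_sum]
    rw [Finset.sum_comm]
    refine Finset.sum_congr rfl fun y' _ => ?_
    rw [Finset.sum_comm]
    exact Finset.sum_congr rfl fun m' _ => Finset.sum_congr rfl fun c _ => by ring
  rw [hswap]
  have hsplit : ∀ (G H : (Fin n → Bool) → ℝ) (r : ℝ),
      ∑ y' : Fin n → Bool, ∑ m' : Fin n → Bool, wt (fun i => p i.succ) y' * wt (fun _ => ε) m'
          * (G (fun j => if m' j = true then y' j else x' j) + r * H (fun j => if m' j = true then y' j else x' j))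
        = (∑ y' : Fin n → Bool, ∑ m' : Fin n → Bool, wt (fun i => p i.succ) y' * wt (fun _ => ε) m'
            * G (fun j => if m' j = true then y' j else x' j))
          + r * ∑ y' : Fin n → Bool, ∑ m' : Fin n → Bool, wt (fun i => p i.succ) y' * wt (fun _ => ε) m'
            * H (fun j => if m' j = true then y' j else x' j) := by
    intro G H r
    simp only [Finset.mul_sum, ← Finset.sum_add_distrib]
    exact Finset.sum_congr rfl fun y' _ => Finset.sum_congr rfl fun m' _ => by ring
  rw [hsplit (fun z => ∑ c : Bool, coordWt p 0 c * f (Fin.cons c z))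
    (fun z => ∑ c : Bool, coordWt p 0 c * ((((if c then (1 : ℝ) else 0) - p 0) / Real.sqrt (p 0 * (1 - p 0))) * f (Fin.cons c z)))]
  ring

/-- **THE TWO-POINT INEQUALITY, POINTWISE IN THE OTHER COORDINATES**: with `ρ = 1 − ε`, `ρ² ≤ 1/4` and `3ρ⁴ ≤ p₀(1−p₀)` (if `0 < p₀ < 1`),
`Σ_b w₀(b)·(T_ε f(b,x'))⁴ ≤ (T'g)⁴ + 2(T'g)²(T'h)² + (T'h)⁴` at every `x'`.
[cite: ODonnell2014, §9.1 (proof of Thm 9.21: E_{x_n}[(T_ρ g + ρ x_n T_ρ h)⁴] ≤ …) and §10.1 Thm 10.21] -/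
theorem fourth_moment_cons_le (p : Fin (n + 1) → ℝ) (h0 : ∀ i, 0 ≤ p i) (h1 : ∀ i, p i ≤ 1) {ε : ℝ}
    (hρ2 : (1 - ε) ^ 2 ≤ 1 / 4) (hρ4 : 0 < p 0 → p 0 < 1 → 3 * (1 - ε) ^ 4 ≤ p 0 * (1 - p 0))
    (f : (Fin (n + 1) → Bool) → ℝ) (x' : Fin n → Bool) :
    ∑ b : Bool, coordWt p 0 b * (∑ y : Fin (n + 1) → Bool, ∑ m : Fin (n + 1) → Bool, wt p y * wt (fun _ => ε) m
        * f (fun i => if m i = true then y i else (Fin.cons b x' : Fin (n + 1) → Bool) i)) ^ 4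
      ≤ (∑ y' : Fin n → Bool, ∑ m' : Fin n → Bool, wt (fun i => p i.succ) y' * wt (fun _ => ε) m'
            * (∑ c : Bool, coordWt p 0 c * f (Fin.cons c (fun j => if m' j = true then y' j else x' j)))) ^ 4
        + 2 * ((∑ y' : Fin n → Bool, ∑ m' : Fin n → Bool, wt (fun i => p i.succ) y' * wt (fun _ => ε) m'
            * (∑ c : Bool, coordWt p 0 c * f (Fin.cons c (fun j => if m' j = true then y' j else x' j)))) ^ 2
          * (∑ y' : Fin n → Bool, ∑ m' : Fin n → Bool, wt (fun i => p i.succ) y' * wt (fun _ => ε) m'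
            * (∑ c : Bool, coordWt p 0 c * ((((if c then (1 : ℝ) else 0) - p 0) / Real.sqrt (p 0 * (1 - p 0)))
              * f (Fin.cons c (fun j => if m' j = true then y' j else x' j))))) ^ 2)
        + (∑ y' : Fin n → Bool, ∑ m' : Fin n → Bool, wt (fun i => p i.succ) y' * wt (fun _ => ε) m'
            * (∑ c : Bool, coordWt p 0 c * ((((if c then (1 : ℝ) else 0) - p 0) / Real.sqrt (p 0 * (1 - p 0)))
              * f (Fin.cons c (fun j => if m' j = true then y' j else x' j))))) ^ 4 := by
  set A : ℝ := ∑ y' : Fin n → Bool, ∑ m' : Fin n → Bool, wt (fun i => p i.succ) y' * wt (fun _ => ε) m'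
            * (∑ c : Bool, coordWt p 0 c * f (Fin.cons c (fun j => if m' j = true then y' j else x' j))) with hA
  set B : ℝ := ∑ y' : Fin n → Bool, ∑ m' : Fin n → Bool, wt (fun i => p i.succ) y' * wt (fun _ => ε) m'
            * (∑ c : Bool, coordWt p 0 c * ((((if c then (1 : ℝ) else 0) - p 0) / Real.sqrt (p 0 * (1 - p 0)))
              * f (Fin.cons c (fun j => if m' j = true then y' j else x' j)))) with hB
  have key : ∀ b : Bool, coordWt p 0 b * (∑ y : Fin (n + 1) → Bool, ∑ m : Fin (n + 1) → Bool, wt p y * wt (fun _ => ε) m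
        * f (fun i => if m i = true then y i else (Fin.cons b x' : Fin (n + 1) → Bool) i)) ^ 4
      = coordWt p 0 b * (A + (1 - ε) * (((if b then (1 : ℝ) else 0) - p 0) / Real.sqrt (p 0 * (1 - p 0))) * B) ^ 4 := by
    intro b
    by_cases hb : coordWt p 0 b = 0
    · rw [hb, zero_mul, zero_mul]
    · rw [noise_cons_eq p h0 h1 ε f hb x', hA, hB]
      ring
  rw [Finset.sum_congr rfl (fun b _ => key b), Fintype.sum_bool]
  have h2p := two_point_hypercontractive (p 0) (h0 0) (h1 0) hρ2 hρ4 A B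
  simp only [coordWt, if_true, Bool.false_eq_true, if_false] at h2p ⊢
  exact h2p

end Cons

end Summit.CriticalPhenomena.PercolationContinuityZ3.Theorems.Crossing.Spectral

end
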